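import Summits.QuantumFields.BalabanUV.T4Continuum.Support.VariationalVectorFederbushSum

/-!
# T⁴ programme, spine node NE2 (U1a), lane P2 — SUPPLIER LEAF V-FED, file 3: THE CURL HALF OF THE `hFED` BINDER IN THE ROAD OWNER'S LETTERS
# (`ScV`∕`SfV`∕`qVV` of `VariationalVectorForm`, physical units, one block step of side `L` from level `n·L` to level `n`), and the whole binder
# from a displayed one-step consistency of the gauge∕curvature functional `G` (leaf V-GF's output shape)
# (`t4/skeletons/NE2-t4-ne2-p2.md` v0.14 §2.E rows V-FED ∕ V-GF; cell `pub-balaban`)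

NE2 formalisation swarm `b2b-balaban-t4-ne2-formalise-*`, leaf prover 01 GEN 5 (`prover-b2b-balaban-t4-ne2-formalise-leaf-01-g5-0`); file 3 of the V-FED line
(journal INTENT CLAIMS.log 2026-08-20 11:03Z), on top of file 2 `VariationalVectorFederbushSum.curlSq_QvL_le` (lattice units) and the owner's
`VariationalVectorForm` (decision (D2): `ScV n M R G W = n^{−d}·(n²·(½·curlSq R W + G W))`, `SfV`, `qVV`; the bracket `vector_pair_bracket_sqrt` whose binder
  `hFED : ∀ W′, ScV n M R G (Q₁ W′) ≤ (√(SfV n L M R′ G′ W′) + δ·√(qVV n L M W′))²`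
this file inhabits for `Q₁ := QvL L (fine n M) T` — the LINE-indexed one-step average, RULING l.11674 — and, by `QvT_eq_QvL` (rfl), for `Q₁ := QvT L (fine n M) Tl′`).

THE STATEMENTS (model level; `E` any normed ℂ-space; coarse level `n`, fine level `n·L`, one-step coordinates `Tor (fine L (fine n M))`; data as in files 1–2:
coarse bond transports `Rc` on `Tor (fine n M)`, fine bond transports `R′` (`‖R′‖ ≤ 1`), line transports `T(y,j,t,μ)` (`‖T‖ ≤ 1`), (M1) `‖misL‖ ≤ m`, (M2) comb
defect `≤ w′`).
 * **`ScV_QvL_le_curl`** (the CURL HALF, no `G`): with `G = 0` at the coarse level and any `G′ ≥ 0` at the fine level,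
   `ScV n M Rc 0 (Q_T W′) ≤ ( √(SfV n L M R′ G′ W′) + d·n·(2m + 2L·w′)·√(qVV n L M W′) )²` — `hFED` with `δ_curl = d·n·(2m + 2Lw′)` (`= O(n·m)`, skeleton §2.E).
 * **`ScV_QvL_le`** (the WHOLE binder from V-GF's shape): if the DATA functional `G` passes one block step in the same additive square-root currency,
   (GF2) `n^{−d}·n²·G(Q_T W′) ≤ ( √((nL)^{−d}(nL)²·G′ W′) + δ_G·√(qVV W′) )²` (displayed hypothesis — leaf V-GF, NOT proved here), then
   `ScV n M Rc G (Q_T W′) ≤ ( √(SfV n L M R′ G′ W′) + (d·n·(2m + 2Lw′) + δ_G)·√(qVV n L M W′) )²` (`(√a+α)² + (√b+β)² ≤ (√(a+b) + α + β)²`).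
 * `ScV_QvT_le_curl` — the bond-indexed one-step special case (`QvT`, the owner's `vector_pair_bracket_sqrt_bond`), by `QvT_eq_QvL`.
SCALING (the only content beyond file 2): `n^{2−d}·L^{2−d} = (nL)^{2−d}` puts the main term's constant-1 lattice bound EXACTLY onto `√SfV`'s curl half, and
`½·n^{2−d}·Y′∕L^d ≤ n²·qVV W′` turns file 2's `(2m + 2Lw′)√(Y′∕L^d)` into `n·(2m + 2Lw′)·√qVV` (the `½` of (D2) dropped on the defect side).
WHAT IS NOT HERE: (GF2) itself (leaf V-GF: the scalar END composed with row B4.a's sandwich shape), the sizes of `(m, w′)` (taxi∕CLASS lineage), V-ONE∕V-P∕V-REG,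
the END (successor owner).

HONEST FRAMING (T4-DAG p. 1).  Model level; transports and `G`, `G′` DATA; [folklore] real arithmetic on top of files 1–2; nothing printed is a hypothesis; no
`def`, no `def … : Prop`, no `sorry`; axioms standard.  NE2 NOT proved; spine PROVED 0∕9 unchanged; rung (B)+1 finite T⁴ — NOT infinite volume, NOT mass gap, NOT
Clay.  HONEST DEPENDENCY (cell, verbatim): continuum YM on T⁴ ⇐ BetaPertH ∧ nine spine estimates (0/9 proved); BetaPertH ⇐ (D1) ∧ (D4) ∧ CAP+tail; G-an2-4
gates asym, D1 and NE2/3/4.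
-/

noncomputable section

namespace Summit.QuantumFields.BalabanUV.T4Continuum.VariationalVectorFederbush

open Finset
open Literature.MathematicalPhysics.QuantumFieldTheory.Balaban1983to89
open Literature.MathematicalPhysics.QuantumFieldTheory.Balaban1983to89.B5Prop11Plancherel (Tor fine unitVec)
open Literature.MathematicalPhysics.QuantumFieldTheory.Balaban1983to89.B5Block118 (tstep bpt)
open Summit.QuantumFields.BalabanUV.T4Continuum.VectorBlockTrialForm (nsqV nsqV_nonneg QvL QvT QvT_eq_QvL)
open Summit.QuantumFields.BalabanUV.T4Continuum.VariationalVectorForm (curlSq curlSq_nonneg ScV SfV qVV qVV_nonneg)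

variable {d : ℕ} {E : Type*} [NormedAddCommGroup E] [NormedSpace ℂ E]
variable (n L : ℕ) [NeZero n] [NeZero L] (M : Fin d → ℕ) [hM : ∀ μ, NeZero (M μ)]

/-! ## §5 Two real-arithmetic lemmas -/

omit [NeZero n] [NeZero L] hM in
/-- `(√a + α)² + (√b + β)² ≤ (√(a + b) + (α + β))²` for nonnegative `a, b, α, β` (`√a, √b ≤ √(a+b)`, `α² + β² ≤ (α+β)²`). [folklore] -/
theorem sq_sqrt_add_sq_sqrt_add_le {a b α β : ℝ} (ha : 0 ≤ a) (hb : 0 ≤ b) (hα : 0 ≤ α) (hβ : 0 ≤ β) :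
    (Real.sqrt a + α) ^ 2 + (Real.sqrt b + β) ^ 2 ≤ (Real.sqrt (a + b) + (α + β)) ^ 2 := by
  have h1 : Real.sqrt a ≤ Real.sqrt (a + b) := Real.sqrt_le_sqrt (by linarith)
  have h2 : Real.sqrt b ≤ Real.sqrt (a + b) := Real.sqrt_le_sqrt (by linarith)
  have hab : Real.sqrt (a + b) ^ 2 = a + b := Real.sq_sqrt (by linarith)
  nlinarith [Real.sq_sqrt ha, Real.sq_sqrt hb, mul_le_mul_of_nonneg_right h1 hα, mul_le_mul_of_nonneg_right h2 hβ,
    Real.sqrt_nonneg a, Real.sqrt_nonneg b, mul_nonneg hα hβ]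

omit hM in
/-- **THE SCALING STEP**: from file 2's lattice bound `C̄ ≤ (√(L²C′∕L^d) + δ₀√(Y′∕L^d))²` at block side `L` to the physical normalisation of (D2):
`n^{−d}(n²·C̄∕2) ≤ ( √((nL)^{−d}((nL)²·(C′∕2))) + δ₀·n·√((nL)^{−d}·Y′) )²` (`n^{2−d}L^{2−d} = (nL)^{2−d}`; `½` dropped on the defect side). [folklore] -/
theorem scale_curl_bound {Cc Cf Y δ₀ : ℝ} (hY : 0 ≤ Y) (hδ : 0 ≤ δ₀)
    (h : Cc ≤ (Real.sqrt ((L : ℝ) ^ 2 * Cf / (L : ℝ) ^ d) + δ₀ * Real.sqrt (Y / (L : ℝ) ^ d)) ^ 2) :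
    ((n : ℝ) ^ d)⁻¹ * ((n : ℝ) ^ 2 * (Cc / 2))
      ≤ (Real.sqrt ((((n : ℝ) * L) ^ d)⁻¹ * (((n : ℝ) * L) ^ 2 * (Cf / 2))) + δ₀ * n * Real.sqrt ((((n : ℝ) * L) ^ d)⁻¹ * Y)) ^ 2 := by
  have hn : (0 : ℝ) < n := by exact_mod_cast Nat.pos_of_ne_zero (NeZero.ne n)
  have hL : (0 : ℝ) < L := by exact_mod_cast Nat.pos_of_ne_zero (NeZero.ne L)
  have hnd : (0 : ℝ) < (n : ℝ) ^ d := by positivity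
  have hLd : (0 : ℝ) < (L : ℝ) ^ d := by positivity
  -- the half prefactor `k = n²∕(2n^d)`
  set k : ℝ := ((n : ℝ) ^ d)⁻¹ * (n : ℝ) ^ 2 / 2 with hk
  have hk0 : 0 ≤ k := by positivity
  set A : ℝ := Real.sqrt ((L : ℝ) ^ 2 * Cf / (L : ℝ) ^ d) with hA
  set B : ℝ := Real.sqrt (Y / (L : ℝ) ^ d) with hB
  have hA0 : 0 ≤ A := Real.sqrt_nonneg _
  have hB0 : 0 ≤ B := Real.sqrt_nonneg _
  -- main term: `√k·A = √((nL)^{−d}((nL)²(C′/2)))`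
  have e1 : Real.sqrt k * A = Real.sqrt ((((n : ℝ) * L) ^ d)⁻¹ * (((n : ℝ) * L) ^ 2 * (Cf / 2))) := by
    rw [hA, ← Real.sqrt_mul hk0]
    congr 1
    rw [hk, mul_pow, mul_pow]
    field_simp
  -- defect term: `√k·B ≤ n·√((nL)^{−d}Y)` (drop the `½`)
  have e2 : Real.sqrt k * B ≤ n * Real.sqrt ((((n : ℝ) * L) ^ d)⁻¹ * Y) := by
    rw [hB, ← Real.sqrt_mul hk0]
    have e : (n : ℝ) * Real.sqrt ((((n : ℝ) * L) ^ d)⁻¹ * Y) = Real.sqrt ((n : ℝ) ^ 2 * ((((n : ℝ) * L) ^ d)⁻¹ * Y)) := by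
      rw [Real.sqrt_mul (sq_nonneg _), Real.sqrt_sq hn.le]
    rw [e]
    refine Real.sqrt_le_sqrt ?_
    have hq : 0 ≤ (((n : ℝ) * L) ^ d)⁻¹ * Y := by positivity
    have e' : k * (Y / (L : ℝ) ^ d) = (1 / 2) * ((n : ℝ) ^ 2 * ((((n : ℝ) * L) ^ d)⁻¹ * Y)) := by
      rw [hk, mul_pow]; field_simp
    rw [e']
    nlinarith [sq_nonneg (n : ℝ)]
  have hsq : Real.sqrt k ^ 2 = k := Real.sq_sqrt hk0
  calc ((n : ℝ) ^ d)⁻¹ * ((n : ℝ) ^ 2 * (Cc / 2)) = k * Cc := by rw [hk]; ring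
    _ ≤ k * (A + δ₀ * B) ^ 2 := mul_le_mul_of_nonneg_left h hk0
    _ = (Real.sqrt k * A + δ₀ * (Real.sqrt k * B)) ^ 2 := by
        rw [show (Real.sqrt k * A + δ₀ * (Real.sqrt k * B)) ^ 2 = Real.sqrt k ^ 2 * (A + δ₀ * B) ^ 2 by ring, hsq]
    _ ≤ (Real.sqrt k * A + δ₀ * (n * Real.sqrt ((((n : ℝ) * L) ^ d)⁻¹ * Y))) ^ 2 := by
        have hl : 0 ≤ Real.sqrt k * A + δ₀ * (Real.sqrt k * B) := by positivity
        exact pow_le_pow_left₀ hl (by gcongr) 2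
    _ = _ := by rw [e1]; ring

/-! ## §6 The curl half of `hFED`, and the whole binder from (GF2) -/

variable {Rc : Tor (fine n M) → Fin d → (E →L[ℂ] E)} {R' : Tor (fine L (fine n M)) → Fin d → (E →L[ℂ] E)}
  {T : Tor (fine n M) → (Fin d → Fin L) → Fin L → Fin d → (E →L[ℂ] E)}

/-- **LEAF V-FED, THE WHOLE `hFED` BINDER FROM (GF2)** (physical units, the owner's letters; `Q₁ := QvL L (fine n M) T` line-indexed): contractive `R′`, `T`;
(M1) `‖misL‖ ≤ m`; (M2) comb defect `≤ w′`; `0 ≤ G′`; and the DISPLAYED one-step consistency of the gauge∕curvature functional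
(GF2) `n^{−d}·(n²·G(Q_T W′)) ≤ (√((nL)^{−d}((nL)²·G′W′)) + δ_G·√(qVV W′))²` (leaf V-GF's output; NOT proved here).  THEN
`ScV n M Rc G (Q_T W′) ≤ ( √(SfV n L M R′ G′ W′) + (d·n·(2m + 2L·w′) + δ_G)·√(qVV n L M W′) )²`. [folklore] -/
theorem ScV_QvL_le (hR' : ∀ x μ, ‖R' x μ‖ ≤ 1) (hT : ∀ y j t μ, ‖T y j t μ‖ ≤ 1) {m w' : ℝ} (hm : 0 ≤ m) (hw' : 0 ≤ w')
    (hmis : ∀ y j t μ ν, ‖misL L (fine n M) Rc R' T y j t μ ν‖ ≤ m)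
    (hpath : ∀ y j s t μ ν, ‖pathL L (fine n M) R' T y j s t μ ν - pathL L (fine n M) R' T y j t s ν μ‖ ≤ w')
    {G : (Tor (fine n M) → Fin d → E) → ℝ} {G' : (Tor (fine L (fine n M)) → Fin d → E) → ℝ} (hG0' : ∀ W', 0 ≤ G' W') {δG : ℝ} (hδG : 0 ≤ δG)
    (hGF : ∀ W', ((n : ℝ) ^ d)⁻¹ * ((n : ℝ) ^ 2 * G (QvL L (fine n M) T W'))
      ≤ (Real.sqrt ((((n : ℝ) * L) ^ d)⁻¹ * (((n : ℝ) * L) ^ 2 * G' W')) + δG * Real.sqrt (qVV n L M W')) ^ 2)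
    (W' : Tor (fine L (fine n M)) → Fin d → E) :
    ScV n M Rc G (QvL L (fine n M) T W')
      ≤ (Real.sqrt (SfV n L M R' G' W') + ((d : ℝ) * ((n : ℝ) * (2 * m + 2 * L * w')) + δG) * Real.sqrt (qVV n L M W')) ^ 2 := by
  have hn : (0 : ℝ) ≤ n := Nat.cast_nonneg n
  have hnL : (0 : ℝ) < ((n : ℝ) * L) ^ d := by
    have := Nat.pos_of_ne_zero (NeZero.ne n); have := Nat.pos_of_ne_zero (NeZero.ne L); positivity
  set Cf : ℝ := curlSq (fine L (fine n M)) R' W' with hCf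
  set Y : ℝ := nsqV (fine L (fine n M)) W' with hY
  have hY0 : 0 ≤ Y := nsqV_nonneg _ W'
  have hδ0 : 0 ≤ (d : ℝ) * (2 * m + 2 * L * w') := by positivity
  -- file 2 at block side `L`, coarse torus `fine n M`
  have hlat : curlSq (fine n M) Rc (QvL L (fine n M) T W')
      ≤ (Real.sqrt ((L : ℝ) ^ 2 * Cf / (L : ℝ) ^ d) + (d : ℝ) * (2 * m + 2 * L * w') * Real.sqrt (Y / (L : ℝ) ^ d)) ^ 2 := by
    simpa only [mul_assoc] using curlSq_QvL_le L (fine n M) hR' hT hm hw' hmis hpath W'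
  have hcurl := scale_curl_bound n L (d := d) hY0 hδ0 hlat
  -- the two halves
  set a : ℝ := (((n : ℝ) * L) ^ d)⁻¹ * (((n : ℝ) * L) ^ 2 * (Cf / 2)) with ha
  set b : ℝ := (((n : ℝ) * L) ^ d)⁻¹ * (((n : ℝ) * L) ^ 2 * G' W') with hb
  have ha0 : 0 ≤ a := by have := curlSq_nonneg _ R' W'; positivity
  have hb0 : 0 ≤ b := by have := hG0' W'; positivity
  have hq : Real.sqrt ((((n : ℝ) * L) ^ d)⁻¹ * Y) = Real.sqrt (qVV n L M W') := by rw [hY]; rfl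
  rw [hq] at hcurl
  have hα : 0 ≤ (d : ℝ) * (2 * m + 2 * L * w') * n * Real.sqrt (qVV n L M W') := by positivity
  have hβ : 0 ≤ δG * Real.sqrt (qVV n L M W') := by positivity
  have key := sq_sqrt_add_sq_sqrt_add_le ha0 hb0 hα hβ
  have hS : ScV n M Rc G (QvL L (fine n M) T W')
      = ((n : ℝ) ^ d)⁻¹ * ((n : ℝ) ^ 2 * (curlSq (fine n M) Rc (QvL L (fine n M) T W') / 2))
        + ((n : ℝ) ^ d)⁻¹ * ((n : ℝ) ^ 2 * G (QvL L (fine n M) T W')) := by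
    unfold ScV; ring
  have hSf : SfV n L M R' G' W' = a + b := by
    rw [ha, hb, hCf]; unfold SfV; ring
  rw [hS, hSf]
  calc _ ≤ (Real.sqrt a + (d : ℝ) * (2 * m + 2 * L * w') * n * Real.sqrt (qVV n L M W')) ^ 2 + (Real.sqrt b + δG * Real.sqrt (qVV n L M W')) ^ 2 :=
        add_le_add hcurl (hGF W')
    _ ≤ _ := key
    _ = _ := by ring

/-- **LEAF V-FED, THE CURL HALF** (no gauge term at the coarse level, any nonnegative `G′` at the fine level — `SfV` is monotone in `G′`):
`ScV n M Rc 0 (Q_T W′) ≤ ( √(SfV n L M R′ G′ W′) + d·n·(2m + 2L·w′)·√(qVV n L M W′) )²` — the `hFED` binder of `VariationalVectorForm.vector_pair_bracket_sqrt`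
for the pure curl form with `δ = d·n·(2m + 2Lw′)`; main term constant EXACTLY 1. [folklore] -/
theorem ScV_QvL_le_curl (hR' : ∀ x μ, ‖R' x μ‖ ≤ 1) (hT : ∀ y j t μ, ‖T y j t μ‖ ≤ 1) {m w' : ℝ} (hm : 0 ≤ m) (hw' : 0 ≤ w')
    (hmis : ∀ y j t μ ν, ‖misL L (fine n M) Rc R' T y j t μ ν‖ ≤ m)
    (hpath : ∀ y j s t μ ν, ‖pathL L (fine n M) R' T y j s t μ ν - pathL L (fine n M) R' T y j t s ν μ‖ ≤ w')
    {G' : (Tor (fine L (fine n M)) → Fin d → E) → ℝ} (hG0' : ∀ W', 0 ≤ G' W') (W' : Tor (fine L (fine n M)) → Fin d → E) :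
    ScV n M Rc (fun _ => 0) (QvL L (fine n M) T W')
      ≤ (Real.sqrt (SfV n L M R' G' W') + (d : ℝ) * ((n : ℝ) * (2 * m + 2 * L * w')) * Real.sqrt (qVV n L M W')) ^ 2 := by
  have h := ScV_QvL_le n L M hR' hT hm hw' hmis hpath (G := fun _ => 0) hG0' le_rfl (δG := 0) (fun W' => by
    have hb : 0 ≤ (((n : ℝ) * L) ^ d)⁻¹ * (((n : ℝ) * L) ^ 2 * G' W') := by have := hG0' W'; positivity
    simp only [mul_zero, zero_mul, add_zero]
    positivity) W'
  simpa only [add_zero] using h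

/-- **THE BOND-INDEXED ONE-STEP CASE** (`Q₁ := QvT L (fine n M) Tl′`, the owner's `vector_pair_bracket_sqrt_bond`): `QvT Tl′ = QvL (y j t μ ↦ Tl′(L·y + j + t e_μ, μ))`
(`QvT_eq_QvL`, rfl), so the curl half of `hFED` holds with the mismatch binders (M1)∕(M2) read on the induced line transports. [folklore] -/
theorem ScV_QvT_le_curl {Tl' : Tor (fine L (fine n M)) → Fin d → (E →L[ℂ] E)} (hR' : ∀ x μ, ‖R' x μ‖ ≤ 1) (hTl : ∀ x μ, ‖Tl' x μ‖ ≤ 1)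
    {m w' : ℝ} (hm : 0 ≤ m) (hw' : 0 ≤ w')
    (hmis : ∀ y j t μ ν, ‖misL L (fine n M) Rc R'
      (fun y j t μ => Tl' (bpt L (fine n M) y j + tstep (fine L (fine n M)) μ t) μ) y j t μ ν‖ ≤ m)
    (hpath : ∀ y j s t μ ν,
      ‖pathL L (fine n M) R' (fun y j t μ => Tl' (bpt L (fine n M) y j + tstep (fine L (fine n M)) μ t) μ) y j s t μ ν
        - pathL L (fine n M) R' (fun y j t μ => Tl' (bpt L (fine n M) y j + tstep (fine L (fine n M)) μ t) μ) y j t s ν μ‖ ≤ w')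
    {G' : (Tor (fine L (fine n M)) → Fin d → E) → ℝ} (hG0' : ∀ W', 0 ≤ G' W') (W' : Tor (fine L (fine n M)) → Fin d → E) :
    ScV n M Rc (fun _ => 0) (QvT L (fine n M) Tl' W')
      ≤ (Real.sqrt (SfV n L M R' G' W') + (d : ℝ) * ((n : ℝ) * (2 * m + 2 * L * w')) * Real.sqrt (qVV n L M W')) ^ 2 := by
  rw [QvT_eq_QvL]
  exact ScV_QvL_le_curl n L M hR' (fun y j t μ => hTl _ _) hm hw' hmis hpath hG0' W'

end Summit.QuantumFields.BalabanUV.T4Continuum.VariationalVectorFederbush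

end
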